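import Literature.AlgebraicGeometry.Motives.AbelianVarietyQuotientFree
import Literature.RingTheory.GaloisAlgebras.GaloisDescentFixedPoints
import HarnessLib

/-!
# The quotient map `h : P ⟶ P/S`

Continuation of `AbelianVarietyQuotientAction` / `AbelianVarietyQuotientFree`. With `Y = P ×_K Spec L`
(`L / K` finite Galois), `G = S ⋊ Aut(L/K)` acting freely on `Y` over `P` via `r = pr ≫ q`, and the
quotient `P/S := Y/G = Spec_P((r_* 𝒪_Y)^G)` (`quotAction`, `ActionOver.quotient`), this file
constructs the morphism **`h : P ⟶ P/S`** through which the quotient map `π : Y → Y/G` factors: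

* `isPushout_appLE_fst`, `isPushout_sections`: for every open `V ⊆ P`, `Γ(Y, pr⁻¹V)` is the
  pushout `L ⊗_K Γ(P, V)` (Mathlib `isIso_pushoutSection_of_isQuasiSeparated_of_flat_right`;
  `P` is noetherian);
* `exists_prApp_eq`, `prApp_injective`: a `Aut(L/K)`-invariant section of `Y` over
  `r⁻¹U = pr⁻¹(q⁻¹U)` is the pull-back of a unique section of `P` over `q⁻¹U` (Galois descent,
  `Literature.RingTheory.GaloisAlgebras.mem_range_of_isPushout_of_forall_eq`);
* `descentHom`, `descentTrans`: the resulting maps `(r_* 𝒪_Y)^G(U) → Γ(P, q⁻¹U)`, a map of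
  presheaves of `𝒪_P`-algebras (`diagramMap_descentTrans`);
* `quotientMap` (`h`): the lift of `q` along `descentTrans`
  (`SubringDatum.lift`), with `quotientMap_quotientToBase : h ≫ (P/S → P) = q`,
  `fst_quotientMap : pr ≫ h = π`, `isFinite_quotientMap`, `surjective_quotientMap`.

Mumford, *Abelian Varieties*, §7, Thm. 4 (p. 72) and the Theorem on p. 66, §12;
Görtz–Wedhorn II, Thm. 27.68 (quotients by finite group schemes) — here `P → P/S` is obtained
from `Y → Y/G` by Galois descent built into the group `G`.

## References

* [MumfordAV1970] D. Mumford, *Abelian Varieties* (1970), §7 (Thm. p. 66, Thm. 4 p. 72), §12.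
* [GortzWedhorn2023] U. Görtz, T. Wedhorn, *Algebraic Geometry II* (2023), Thm. 27.68.
-/

noncomputable section

universe u

open CategoryTheory CategoryTheory.Limits AlgebraicGeometry
open scoped TensorProduct

namespace Literature.AlgebraicGeometry.Motives

namespace AbelianVariety

open scoped MonObj Obj
open Literature.AlgebraicGeometry.RelativeSpec

variable {K : Type u} [Field K] (L : Type u) [Field L] [Algebra K L] (P : AbelianVariety K)
variable (S : Subgroup (P.Points L))
  (hS : ∀ (σ : L ≃ₐ[K] L) (s : P.Points L), s ∈ S → σ • s ∈ S)
  (q : P ⟶ P) (hSq : ∀ s ∈ S, s ≫ q.hom.hom.hom = 1)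

/-! ### Galois elements fix the functions pulled back from `P` -/

/-- The Galois element `(1, σ)` of `S ⋊ Aut(L/K)` acts on `Y` by `gal σ`. [folklore] -/
theorem quotAction_aut_inr_hom (σ : L ≃ₐ[K] L) :
    ((P.quotAction L S hS q hSq).aut (SemidirectProduct.inr σ)).hom = P.gal L σ := by
  rw [quotAction_aut_hom, SemidirectProduct.right_inr, SemidirectProduct.left_inr,
    OneMemClass.coe_one, transl_one, Category.comp_id]

/-- The pull-back of functions along `pr : Y → P`, from `q⁻¹U` to `r⁻¹U = pr⁻¹(q⁻¹U)`.
[folklore] -/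
abbrev prApp (U : P.X.left.Opens) :
    Γ(P.X.left, Hom.toSchemeHom q ⁻¹ᵁ U) ⟶ Γ(P.bcLeft L, P.quotR L q ⁻¹ᵁ U) :=
  (pullback.fst P.X.hom (bcSpec K L)).appLE (Hom.toSchemeHom q ⁻¹ᵁ U) (P.quotR L q ⁻¹ᵁ U)
    le_rfl

/-- Galois elements `(1, σ)` of `S ⋊ Aut(L/K)` fix the sections pulled back along `pr : Y → P`:
`act (1, σ) (pr♯ c) = pr♯ c` (since `gal σ⁻¹ ≫ pr = pr`). [folklore] -/
theorem act_inr_prApp (U : P.X.left.Opens) (σ : L ≃ₐ[K] L)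
    (c : Γ(P.X.left, Hom.toSchemeHom q ⁻¹ᵁ U)) :
    (P.quotAction L S hS q hSq).act (SemidirectProduct.inr σ) U (P.prApp L q U c) =
      P.prApp L q U c := by
  have hfst : ((P.quotAction L S hS q hSq).aut (SemidirectProduct.inr σ)⁻¹).hom ≫
      pullback.fst P.X.hom (bcSpec K L) = pullback.fst P.X.hom (bcSpec K L) := by
    rw [← map_inv, quotAction_aut_inr_hom, gal_fst]
  rw [ActionOver.act_apply, ← CommRingCat.comp_apply, Scheme.Hom.appLE_comp_appLE]
  simp only [Scheme.Hom.appLE, Scheme.Hom.congr_app hfst, Category.assoc, ← Functor.map_comp]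
  rfl

/-! ### The sections of `Y = P ×_K Spec L` over `pr⁻¹V` as a pushout -/

section Pushout

variable (V : P.X.left.Opens)

/-- `Γ(Y, pr⁻¹V)` is the pushout of `Γ(Spec L) ← Γ(Spec K) → Γ(P, V)` in `CommRingCat` for every
open `V ⊆ P` (Mathlib `isIso_pushoutSection_of_isQuasiSeparated_of_flat_right`: `Spec L → Spec K`
is flat and `V` is quasi-compact and quasi-separated, `P` being noetherian). [folklore] -/
theorem isPushout_appLE_fst :
    IsPushout (P.X.hom.appLE ⊤ V le_top) ((bcSpec K L).appLE ⊤ ⊤ le_top)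
      ((pullback.fst P.X.hom (bcSpec K L)).appLE V
        (pullback.fst P.X.hom (bcSpec K L) ⁻¹ᵁ V) le_rfl)
      ((pullback.snd P.X.hom (bcSpec K L)).appLE ⊤
        (pullback.fst P.X.hom (bcSpec K L) ⁻¹ᵁ V) le_top) := by
  haveI : IsLocallyNoetherian P.X.left := LocallyOfFiniteType.isLocallyNoetherian P.X.hom
  haveI : IsNoetherian P.X.left := {}
  have hUY : pullback.fst P.X.hom (bcSpec K L) ⁻¹ᵁ V =
      pullback.fst P.X.hom (bcSpec K L) ⁻¹ᵁ V ⊓ pullback.snd P.X.hom (bcSpec K L) ⁻¹ᵁ ⊤ := by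
    simp
  have hiso := isIso_pushoutSection_of_isQuasiSeparated_of_flat_right
    (IsPullback.of_hasPullback P.X.hom (bcSpec K L)) (US := ⊤) (UT := ⊤) (UX := V) le_top le_top
    hUY (isAffineOpen_top _) (isAffineOpen_top _) (TopologicalSpace.NoetherianSpace.isCompact _)
    (IsQuasiSeparated.of_quasiSeparatedSpace _)
  exact (isIso_pushoutSection_iff _ _ _ _).mp hiso

/-- The same pushout with `K` and `L` in place of `Γ(Spec K)`, `Γ(Spec L)`: `Γ(Y, pr⁻¹V)` is
the pushout of `L ← K → Γ(P, V)`, i.e. `Γ(Y, pr⁻¹V) ≅ L ⊗_K Γ(P, V)`. [folklore] -/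
theorem isPushout_sections :
    IsPushout (CommRingCat.ofHom (algebraMap K L))
      ((Scheme.ΓSpecIso (.of K)).inv ≫ P.X.hom.appLE ⊤ V le_top)
      ((Scheme.ΓSpecIso (.of L)).inv ≫ (pullback.snd P.X.hom (bcSpec K L)).appLE ⊤
        (pullback.fst P.X.hom (bcSpec K L) ⁻¹ᵁ V) le_top)
      ((pullback.fst P.X.hom (bcSpec K L)).appLE V
        (pullback.fst P.X.hom (bcSpec K L) ⁻¹ᵁ V) le_rfl) := by
  refine IsPushout.of_iso (P.isPushout_appLE_fst L V).flip (Scheme.ΓSpecIso (.of K))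
    (Scheme.ΓSpecIso (.of L)) (Iso.refl _) (Iso.refl _) ?_ ?_ ?_ ?_
  · -- naturality of `ΓSpecIso`
    have h := Scheme.ΓSpecIso_naturality (CommRingCat.ofHom (algebraMap K L))
    rw [← h]
    congr 1
  · simp
  · simp
  · simp

end Pushout

/-! ### Galois-invariant sections of `Y` over `r⁻¹U` descend to `P` -/

variable [FiniteDimensional K L] [IsGalois K L]

/-- **Galois descent for sections.** A section of `Y = P_L` over `r⁻¹U = pr⁻¹(q⁻¹U)` fixed by
all Galois elements `(1, σ)` is the pull-back of a (unique) section of `P` over `q⁻¹U`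
(`Literature.RingTheory.GaloisAlgebras.mem_range_of_isPushout_of_forall_eq` applied to the
pushout `Γ(Y, pr⁻¹V) ≅ L ⊗_K Γ(P, V)`). [folklore] -/
theorem exists_prApp_eq (U : P.X.left.Opens) (d : Γ(P.bcLeft L, P.quotR L q ⁻¹ᵁ U))
    (hd : ∀ σ : L ≃ₐ[K] L,
      (P.quotAction L S hS q hSq).act (SemidirectProduct.inr σ) U d = d) :
    ∃ c : Γ(P.X.left, Hom.toSchemeHom q ⁻¹ᵁ U), P.prApp L q U c = d := by
  set V : P.X.left.Opens := Hom.toSchemeHom q ⁻¹ᵁ U with hV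
  -- the pushout square, algebraized
  let iC : CommRingCat.of K ⟶ Γ(P.X.left, V) :=
    (Scheme.ΓSpecIso (.of K)).inv ≫ P.X.hom.appLE ⊤ V le_top
  let iL : CommRingCat.of L ⟶ Γ(P.bcLeft L, pullback.fst P.X.hom (bcSpec K L) ⁻¹ᵁ V) :=
    (Scheme.ΓSpecIso (.of L)).inv ≫ (pullback.snd P.X.hom (bcSpec K L)).appLE ⊤ _ le_top
  let iD : Γ(P.X.left, V) ⟶ Γ(P.bcLeft L, pullback.fst P.X.hom (bcSpec K L) ⁻¹ᵁ V) :=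
    (pullback.fst P.X.hom (bcSpec K L)).appLE V _ le_rfl
  have sq : IsPushout (CommRingCat.ofHom (algebraMap K L)) iC iL iD := P.isPushout_sections L V
  letI : Algebra K Γ(P.X.left, V) := iC.hom.toAlgebra
  letI : Algebra L Γ(P.bcLeft L, pullback.fst P.X.hom (bcSpec K L) ⁻¹ᵁ V) := iL.hom.toAlgebra
  letI : Algebra Γ(P.X.left, V) Γ(P.bcLeft L, pullback.fst P.X.hom (bcSpec K L) ⁻¹ᵁ V) :=
    iD.hom.toAlgebra
  letI : Algebra K Γ(P.bcLeft L, pullback.fst P.X.hom (bcSpec K L) ⁻¹ᵁ V) :=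
    (iC ≫ iD).hom.toAlgebra
  haveI : IsScalarTower K Γ(P.X.left, V)
      Γ(P.bcLeft L, pullback.fst P.X.hom (bcSpec K L) ⁻¹ᵁ V) :=
    IsScalarTower.of_algebraMap_eq' rfl
  haveI : IsScalarTower K L Γ(P.bcLeft L, pullback.fst P.X.hom (bcSpec K L) ⁻¹ᵁ V) :=
    IsScalarTower.of_algebraMap_eq' (congrArg CommRingCat.Hom.hom sq.w).symm
  haveI : Algebra.IsPushout K L Γ(P.X.left, V)
      Γ(P.bcLeft L, pullback.fst P.X.hom (bcSpec K L) ⁻¹ᵁ V) :=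
    CommRingCat.isPushout_iff_isPushout.mp sq
  -- apply Galois descent
  obtain ⟨c, hc⟩ := Literature.RingTheory.GaloisAlgebras.mem_range_of_isPushout_of_forall_eq
    K L Γ(P.X.left, V) (D := Γ(P.bcLeft L, pullback.fst P.X.hom (bcSpec K L) ⁻¹ᵁ V))
    (fun σ ↦ (P.quotAction L S hS q hSq).act (SemidirectProduct.inr σ) U)
    (fun σ c ↦ P.act_inr_prApp L S hS q hSq U σ c)
    (fun σ l ↦ P.act_scalarSection L S hS q hSq U (SemidirectProduct.inr σ) l)
    d hd
  exact ⟨c, hc⟩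

omit [FiniteDimensional K L] [IsGalois K L] in
/-- `pr♯ : Γ(P, q⁻¹U) → Γ(Y, r⁻¹U)` is injective (`L ⊗_K -` is faithful:
`Γ(P, V) → L ⊗_K Γ(P, V)` is injective). [folklore] -/
theorem prApp_injective (U : P.X.left.Opens) : Function.Injective (P.prApp L q U) := by
  set V : P.X.left.Opens := Hom.toSchemeHom q ⁻¹ᵁ U with hV
  let iC : CommRingCat.of K ⟶ Γ(P.X.left, V) :=
    (Scheme.ΓSpecIso (.of K)).inv ≫ P.X.hom.appLE ⊤ V le_top
  let iL : CommRingCat.of L ⟶ Γ(P.bcLeft L, pullback.fst P.X.hom (bcSpec K L) ⁻¹ᵁ V) :=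
    (Scheme.ΓSpecIso (.of L)).inv ≫ (pullback.snd P.X.hom (bcSpec K L)).appLE ⊤ _ le_top
  let iD : Γ(P.X.left, V) ⟶ Γ(P.bcLeft L, pullback.fst P.X.hom (bcSpec K L) ⁻¹ᵁ V) :=
    (pullback.fst P.X.hom (bcSpec K L)).appLE V _ le_rfl
  have sq : IsPushout (CommRingCat.ofHom (algebraMap K L)) iC iL iD := P.isPushout_sections L V
  letI : Algebra K Γ(P.X.left, V) := iC.hom.toAlgebra
  letI : Algebra L Γ(P.bcLeft L, pullback.fst P.X.hom (bcSpec K L) ⁻¹ᵁ V) := iL.hom.toAlgebra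
  letI : Algebra Γ(P.X.left, V) Γ(P.bcLeft L, pullback.fst P.X.hom (bcSpec K L) ⁻¹ᵁ V) :=
    iD.hom.toAlgebra
  letI : Algebra K Γ(P.bcLeft L, pullback.fst P.X.hom (bcSpec K L) ⁻¹ᵁ V) :=
    (iC ≫ iD).hom.toAlgebra
  haveI : IsScalarTower K Γ(P.X.left, V)
      Γ(P.bcLeft L, pullback.fst P.X.hom (bcSpec K L) ⁻¹ᵁ V) :=
    IsScalarTower.of_algebraMap_eq' rfl
  haveI : IsScalarTower K L Γ(P.bcLeft L, pullback.fst P.X.hom (bcSpec K L) ⁻¹ᵁ V) :=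
    IsScalarTower.of_algebraMap_eq' (congrArg CommRingCat.Hom.hom sq.w).symm
  haveI : Algebra.IsPushout K L Γ(P.X.left, V)
      Γ(P.bcLeft L, pullback.fst P.X.hom (bcSpec K L) ⁻¹ᵁ V) :=
    CommRingCat.isPushout_iff_isPushout.mp sq
  let e := Algebra.IsPushout.equiv K L Γ(P.X.left, V)
    Γ(P.bcLeft L, pullback.fst P.X.hom (bcSpec K L) ⁻¹ᵁ V)
  have he : ∀ c, P.prApp L q U c = e (1 ⊗ₜ c) := fun c ↦ by
    rw [Algebra.IsPushout.equiv_tmul, map_one, one_mul]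
    rfl
  intro c c' h
  rw [he, he] at h
  exact Algebra.TensorProduct.includeRight_injective (algebraMap K L).injective (e.injective h)


/-! ### The descent homomorphism `Γ(Y, r⁻¹U)^G → Γ(P, q⁻¹U)` -/


section DescentHom

variable (U : P.X.left.Opens)

/-- An invariant section of `Y` over `r⁻¹U` is the pull-back of a unique section of `P` over
`q⁻¹U`. [folklore] -/
theorem existsUnique_prApp_eq (d : (P.quotAction L S hS q hSq).invariantsRing U) :
    ∃! c : Γ(P.X.left, Hom.toSchemeHom q ⁻¹ᵁ U), P.prApp L q U c = d := by
  obtain ⟨c, hc⟩ := P.exists_prApp_eq L S hS q hSq U d fun σ ↦ d.2 (SemidirectProduct.inr σ)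
  exact ⟨c, hc, fun c' hc' ↦ P.prApp_injective L q U (hc'.trans hc.symm)⟩

/-- **The descent homomorphism** `φ_U : Γ(Y, r⁻¹U)^G → Γ(P, q⁻¹U)`: the invariant section `d`
goes to the unique `c` with `pr♯ c = d`. [folklore] -/
def descentHom :
    (P.quotAction L S hS q hSq).invariantsRing U →+* Γ(P.X.left, Hom.toSchemeHom q ⁻¹ᵁ U) where
  toFun d := (P.existsUnique_prApp_eq L S hS q hSq U d).exists.choose
  map_one' := P.prApp_injective L q U (by
    rw [(P.existsUnique_prApp_eq L S hS q hSq U 1).exists.choose_spec, map_one]; rfl)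
  map_mul' d d' := P.prApp_injective L q U (by
    rw [(P.existsUnique_prApp_eq L S hS q hSq U (d * d')).exists.choose_spec, map_mul,
      (P.existsUnique_prApp_eq L S hS q hSq U d).exists.choose_spec,
      (P.existsUnique_prApp_eq L S hS q hSq U d').exists.choose_spec]; rfl)
  map_zero' := P.prApp_injective L q U (by
    rw [(P.existsUnique_prApp_eq L S hS q hSq U 0).exists.choose_spec, map_zero]; rfl)
  map_add' d d' := P.prApp_injective L q U (by
    rw [(P.existsUnique_prApp_eq L S hS q hSq U (d + d')).exists.choose_spec, map_add,
      (P.existsUnique_prApp_eq L S hS q hSq U d).exists.choose_spec,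
      (P.existsUnique_prApp_eq L S hS q hSq U d').exists.choose_spec]; rfl)

/-- Defining property of the descent homomorphism: `pr♯ (φ_U d) = d`. [folklore] -/
@[simp]
theorem prApp_descentHom (d : (P.quotAction L S hS q hSq).invariantsRing U) :
    P.prApp L q U (P.descentHom L S hS q hSq U d) = d :=
  (P.existsUnique_prApp_eq L S hS q hSq U d).exists.choose_spec

/-- Characterisation of `φ_U d` as the unique preimage. [folklore] -/
theorem descentHom_eq {d : (P.quotAction L S hS q hSq).invariantsRing U}
    {c : Γ(P.X.left, Hom.toSchemeHom q ⁻¹ᵁ U)} (h : P.prApp L q U c = d) :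
    P.descentHom L S hS q hSq U d = c :=
  P.prApp_injective L q U ((P.prApp_descentHom L S hS q hSq U d).trans h.symm)

end DescentHom

omit [FiniteDimensional K L] [IsGalois K L] in
/-- `pr♯` commutes with restriction. [folklore] -/
theorem map_prApp {U V : P.X.left.Opens} (i : V ≤ U)
    (c : Γ(P.X.left, Hom.toSchemeHom q ⁻¹ᵁ U)) :
    (P.bcLeft L).presheaf.map (homOfLE ((P.quotR L q).preimage_mono i)).op (P.prApp L q U c) =
      P.prApp L q V
        (P.X.left.presheaf.map (homOfLE ((Hom.toSchemeHom q).preimage_mono i)).op c) := by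
  rw [← CommRingCat.comp_apply, ← CommRingCat.comp_apply, Scheme.Hom.appLE_map,
    Scheme.Hom.map_appLE]

variable [Finite S] [IsAffineHom (Hom.toSchemeHom q)]

omit [IsGalois K L] [IsAffineHom (Hom.toSchemeHom q)] in
/-- `S ⋊ Aut(L/K)` is finite for `S` finite and `L / K` finite. [folklore] -/
instance finite_semidirectProduct : Finite (S ⋊[P.galMulAut L S hS] (L ≃ₐ[K] L)) :=
  Finite.of_equiv (S × (L ≃ₐ[K] L))
    { toFun := fun p ↦ ⟨p.1, p.2⟩
      invFun := fun g ↦ (g.1, g.2)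
      left_inv := fun _ ↦ rfl
      right_inv := fun _ ↦ rfl }

/-- **The descent homomorphisms as a map of presheaves** `(r_* 𝒪_Y)^G ⟶ q_* 𝒪_P` on `P`
(naturality from the uniqueness of the preimage and the naturality of `pr♯`). [folklore] -/
def descentTrans : (P.quotAction L S hS q hSq).invariants.diagram ⟶
    (TopologicalSpace.Opens.map (Hom.toSchemeHom q).base).op ⋙ P.X.left.presheaf where
  app U := CommRingCat.ofHom (P.descentHom L S hS q hSq U.unop)
  naturality {U V} i := by
    ext d
    change P.descentHom L S hS q hSq V.unop ((P.quotAction L S hS q hSq).invariants.diagram.map i d) =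
      P.X.left.presheaf.map (homOfLE ((Hom.toSchemeHom q).preimage_mono i.unop.le)).op
        (P.descentHom L S hS q hSq U.unop d)
    refine P.descentHom_eq L S hS q hSq V.unop ?_
    rw [← P.map_prApp L q i.unop.le, prApp_descentHom]
    rfl

/-- The descent map is a map of `𝒪_P`-algebras: `φ_U (r♯ a) = q♯ a`. [folklore] -/
theorem diagramMap_descentTrans (U : P.X.left.Opens) :
    (P.quotAction L S hS q hSq).invariants.diagramMap.app (.op U) ≫
        (P.descentTrans L S hS q hSq).app (.op U) = (Hom.toSchemeHom q).app U := by
  ext a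
  change P.descentHom L S hS q hSq U _ = (Hom.toSchemeHom q).app U a
  refine P.descentHom_eq L S hS q hSq U ?_
  change ((Hom.toSchemeHom q).app U ≫ P.prApp L q U) a = (P.quotR L q).app U a
  rw [Scheme.Hom.app_eq_appLE (P.quotR L q), Scheme.Hom.comp_appLE]

/-! ### The quotient map `h : P ⟶ P/S = Y/G` -/

/-- **The quotient map `h : P ⟶ P/S`**, where `P/S := Y/(S ⋊ Aut(L/K))`: the lift of
`q : P → P` to `Spec_P((r_* 𝒪_Y)^G)` along the descent homomorphisms (Mumford, *Abelian
Varieties*, §7, Thm. 4, p. 72: the quotient `X → X/K`; here `Y → Y/G` factors as `pr ≫ h`).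
[cite: MumfordAV1970, §7 Thm. 4 (p. 72)] -/
def quotientMap : P.X.left ⟶ (P.quotAction L S hS q hSq).quotient :=
  (P.quotAction L S hS q hSq).invariants.lift (Hom.toSchemeHom q) (P.descentTrans L S hS q hSq)

/-- `h ≫ (P/S → P) = q`. [folklore] -/
@[reassoc (attr := simp)]
theorem quotientMap_quotientToBase :
    P.quotientMap L S hS q hSq ≫ (P.quotAction L S hS q hSq).quotientToBase =
      Hom.toSchemeHom q :=
  (P.quotAction L S hS q hSq).invariants.lift_fromSpec _ _ (P.diagramMap_descentTrans L S hS q hSq)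

set_option backward.isDefEq.respectTransparency false in
/-- **`pr ≫ h = π`**: the quotient map `Y → Y/G` factors through `h : P → P/S` (both sides agree
on the charts `r⁻¹U → Spec Γ(Y, r⁻¹U)^G`, as `φ_U ≫ pr♯` is the inclusion of the invariants).
[folklore] -/
theorem fst_quotientMap :
    pullback.fst P.X.hom (bcSpec K L) ≫ P.quotientMap L S hS q hSq =
      (P.quotAction L S hS q hSq).toQuotient := by
  set ρ := P.quotAction L S hS q hSq with hρ
  refine Scheme.Cover.hom_ext ((P.bcLeft L).openCoverOfIsOpenCover _
    (.comap (iSup_affineOpens_eq_top P.X.left) (P.quotR L q).base.1)) _ _ fun U ↦ ?_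
  have hle : P.quotR L q ⁻¹ᵁ U.1 ≤
      pullback.fst P.X.hom (bcSpec K L) ⁻¹ᵁ (Hom.toSchemeHom q ⁻¹ᵁ U.1) := le_rfl
  have e1 := ρ.invariants.ι_lift (Hom.toSchemeHom q) (P.descentTrans L S hS q hSq) U
  have e2 := ρ.invariants.ι_lift (P.quotR L q) ρ.invariants.inclusion U
  have e4 := Scheme.Opens.toSpecΓ_SpecMap_appLE (pullback.fst P.X.hom (bcSpec K L))
    (Hom.toSchemeHom q ⁻¹ᵁ U.1) (P.quotR L q ⁻¹ᵁ U.1) hle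
  have e5 : (P.descentTrans L S hS q hSq).app (.op U.1) ≫
      (pullback.fst P.X.hom (bcSpec K L)).appLE (Hom.toSchemeHom q ⁻¹ᵁ U.1)
        (P.quotR L q ⁻¹ᵁ U.1) hle = ρ.invariants.inclusion.app (.op U.1) := by
    ext d
    exact P.prApp_descentHom L S hS q hSq U.1 d
  change (P.quotR L q ⁻¹ᵁ U.1).ι ≫ pullback.fst P.X.hom (bcSpec K L) ≫
      P.quotientMap L S hS q hSq = (P.quotR L q ⁻¹ᵁ U.1).ι ≫ ρ.toQuotient
  calc (P.quotR L q ⁻¹ᵁ U.1).ι ≫ pullback.fst P.X.hom (bcSpec K L) ≫ P.quotientMap L S hS q hSq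
      = (pullback.fst P.X.hom (bcSpec K L)).resLE _ _ hle ≫ (Hom.toSchemeHom q ⁻¹ᵁ U.1).ι ≫
          ρ.invariants.lift (Hom.toSchemeHom q) (P.descentTrans L S hS q hSq) := by
        rw [← Category.assoc, ← Scheme.Hom.resLE_comp_ι _ hle, Category.assoc]
        rfl
    _ = (pullback.fst P.X.hom (bcSpec K L)).resLE _ _ hle ≫ (Hom.toSchemeHom q ⁻¹ᵁ U.1).toSpecΓ ≫
          Spec.map ((P.descentTrans L S hS q hSq).app (.op U.1)) ≫ ρ.invariants.openCover.f U := by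
        rw [e1]
    _ = (P.quotR L q ⁻¹ᵁ U.1).toSpecΓ ≫ Spec.map ((pullback.fst P.X.hom (bcSpec K L)).appLE
          (Hom.toSchemeHom q ⁻¹ᵁ U.1) (P.quotR L q ⁻¹ᵁ U.1) hle) ≫
          Spec.map ((P.descentTrans L S hS q hSq).app (.op U.1)) ≫ ρ.invariants.openCover.f U := by
        rw [← Category.assoc, ← e4, Category.assoc]
    _ = (P.quotR L q ⁻¹ᵁ U.1).toSpecΓ ≫ Spec.map (ρ.invariants.inclusion.app (.op U.1)) ≫
          ρ.invariants.openCover.f U := by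
        rw [← e5, Spec.map_comp_assoc]
    _ = (P.quotR L q ⁻¹ᵁ U.1).ι ≫ ρ.toQuotient := e2.symm

/-- `h` is finite when `q` is (e.g. an isogeny): `h ≫ (P/S → P) = q` and `P/S → P` is affine,
hence separated. [folklore] -/
theorem isFinite_quotientMap (hq : IsFinite (Hom.toSchemeHom q)) :
    IsFinite (P.quotientMap L S hS q hSq) := by
  apply MorphismProperty.of_postcomp (W := @IsFinite) (W' := @IsSeparated) _
    (P.quotAction L S hS q hSq).quotientToBase
  · infer_instance
  · rw [quotientMap_quotientToBase]
    infer_instance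

/-- **`h` is surjective**: `pr ≫ h = π` is (the action being free,
`quotAction_free` and `ActionOver.surjective_toQuotient`). [folklore] -/
theorem surjective_quotientMap : Surjective (P.quotientMap L S hS q hSq) := by
  have h := (P.quotAction L S hS q hSq).surjective_toQuotient
    (fun U g hg ↦ P.quotAction_free L S hS q hSq U g hg)
  rw [← fst_quotientMap] at h
  exact Surjective.of_comp (pullback.fst P.X.hom (bcSpec K L)) _

end AbelianVariety

end Literature.AlgebraicGeometry.Motives
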